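import Summits.BirchSwinnertonDyer.BirchSwinnertonDyer.Theorems.Rank2Observatory2DescClKillCurveCertE2Defs
import Summits.BirchSwinnertonDyer.BirchSwinnertonDyer.Theorems.Rank2Observatory2DescClSubgroupSieve
import HarnessLib

/-!
# BirchSwinnertonDyer — rank ≥ 2 observatory: KERNEL-2DESC-CL v2.8 — the two-view kill-list certificate with the SUBGROUP SIEVE (complex case), part 1/2: the checker

HONEST FRAMING: per-curve certified theorems and census instruments; no claim on BSD in rank ≥ 2.

Part 1 of 2.  `checkE2KS F cc r ks sv` = the clauses of the v2.7 kill-list checker `checkE2K F cc r ks`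
(`Rank2Observatory2DescClKillCurveCertE2Defs`) VERBATIM except its final count, which is replaced by the subgroup
sieve of `Rank2Observatory2DescClSubgroupSieve`: every class passing `admE2K F cc ks` is listed in `sv` (index lists
into `fam2 cc`), and the search `noSubB (admE2K F cc ks ∅ ·) sv (r+1) [∅]` succeeds — no `∆`-closed family of
`2^(r+1)` surviving classes exists.  Since the image of the descent map is such a family of size `≥ 2^rank`, this
gives `rank E(ℚ) ≤ r` (part 2, `rank_le_of_checkE2KS`) from far fewer kills than the count: for a row with sixteen
admissible classes of a rank-2 curve, three killed classes `c₁, c₂, c₁c₂` outside the image instead of nine.  The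
residue searches `killSearchE2 F cc ks` stay a separate hypothesis, exactly as in v2.7.
New declarations only; nothing landed or staged is touched.  Sorry-free; axioms `propext`, `Classical.choice`,
`Quot.sound`.
[cite: Cassels1991LecturesEllipticCurves, §15] [cite: CremonaAlgorithms1997, §3.6]
-/

set_option linter.dupNamespace false

noncomputable section

open scoped Classical NumberField nonZeroDivisors

open Literature.NumberTheory.NumberFields Polynomial Module NumberField IsDedekindDomain Ideal

namespace Summit.BirchSwinnertonDyer.BirchSwinnertonDyer.Rank2Observatory.TwoDescCl

open TwoDescCubic ClFieldCert TwoDescKill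

section Checkers

variable (F : ClFieldCertE2) (cc : ClCurveCertE2)

/-- A class of the two-view family given by an index list, as a `Finset` (same convention as `ClKillE2.cls`).
[folklore] -/
def survCls (l : List ℕ) : Finset (Fin (fam2 cc).length) :=
  Finset.univ.filter fun j : Fin (fam2 cc).length => j.val ∈ l

/-- The LIVE classes of a row: the listed classes `sv` that pass the sieve `admE2K` (computed once; `≤ |sv|` sieve
evaluations). [folklore] -/
def liveE2KS (ks : List ClKillE2) (sv : List (List ℕ)) : List (Finset (Fin (fam2 cc).length)) :=
  (sv.map (survCls cc)).filter fun V => admE2K F cc ks ∅ V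

/-- **The two-view per-curve `r`-checker with a kill list and the SUBGROUP SIEVE**: the clauses of `checkE2K F cc r ks`
except its count, verbatim; then: every class passing `admE2K` is listed in `sv` (`2^n` sieve evaluations, as the old
count), and the subgroup-sieve search `noSubB` of depth `r + 1` over the live classes — pure list arithmetic — succeeds.
Computable; run by `decide +kernel`. [cite: Cassels1991LecturesEllipticCurves, §15] [cite: CremonaAlgorithms1997, §3.6] -/
def checkE2KS (r : ℕ) (ks : List ClKillE2) (sv : List (List ℕ)) : Bool :=
  decide (deltaShort cc.A cc.B cc.C ≠ 0) &&
    noRootMod cc.pF cc.A cc.B cc.C &&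
    decide (cubicAtCoords F.fe.base.a F.fe.base.b F.fe.base.c ((F.m₁ : ℤ) * cc.A) ((F.m₁ : ℤ) ^ 2 * cc.B)
      ((F.m₁ : ℤ) ^ 3 * cc.C) cc.Xt = (0, 0, 0)) &&
    decide (derivAtCoords F.fe.base.a F.fe.base.b F.fe.base.c ((F.m₁ : ℤ) * cc.A) ((F.m₁ : ℤ) ^ 2 * cc.B) cc.Xt =
      MonicCubic.mulCoords F.fe.base.a F.fe.base.b F.fe.base.c (smulCoords (F.m₁ : ℤ) cc.XD)
        (prodPowCoords F.fe.base.a F.fe.base.b F.fe.base.c [])) &&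
    twoViewCheck F.fe.base.a F.fe.base.b F.fe.base.c F.fe.u F.fe.d F.m₁ F.m₂ cc.Xt cc.Yt &&
    twoViewCheck F.fe.base.a F.fe.base.b F.fe.base.c F.fe.u F.fe.d F.m₁ F.m₂ cc.XD cc.YD &&
    decide (MonicCubic.disc cc.A cc.B cc.C < 0) &&
    decide (normFormZ F.fe.base.a F.fe.base.b F.fe.base.c cc.XD.1 cc.XD.2.1 cc.XD.2.2 ≠ 0) &&
    decide ((normFormZ F.fe.base.a F.fe.base.b F.fe.base.c cc.XD.1 cc.XD.2.1 cc.XD.2.2).natAbs =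
      (cc.dn.map fun pe => pe.1 ^ pe.2).prod) &&
    (cc.dn.all fun pe => primeDispatch F cc cc.XD cc.YD cc.dinvA cc.dinvE pe.1) &&
    (cc.codes.all fun bc => codeClause F cc bc) &&
    invCert F.fe.base.a F.fe.base.b F.fe.base.c F.fe.base.w₁ cc.XD cc.dW1 &&
    invCert F.fe.base.a F.fe.base.b F.fe.base.c F.fe.base.w₂ cc.XD cc.dW2 &&
    (cc.Q.all fun q => decide (0 < q)) &&
    decide (cc.head.length = 4) &&
    ((fam2 cc).all fun f => famCheckE2 F cc f) &&
    decide (∀ T : Finset (Fin (fam2 cc).length), T ≠ ∅ →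
      ∃ k : Fin (F.fe.base.chars.length + 3), Odd (T.filter fun j => bit2 F cc k j = true).card) &&
    (ks.all fun k => k.lite F cc) &&
    decide (∀ U : Finset (Fin (fam2 cc).length), admE2K F cc ks ∅ U = true → U ∈ sv.map (survCls cc)) &&
    noSubB (fun U => decide (U ∈ liveE2KS F cc ks sv)) (liveE2KS F cc ks sv) (r + 1) [∅]

end Checkers

end Summit.BirchSwinnertonDyer.BirchSwinnertonDyer.Rank2Observatory.TwoDescCl

end
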